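import Summits.QuantumFields.YangMills.Theorems.UnitScaleTiltProp8HalvingDressingLetterX2
import Summits.QuantumFields.YangMills.Theorems.UnitScaleTiltProp8FlatHCurlCurlMatrix
import Summits.QuantumFields.YangMills.Theorems.UnitScaleTiltProp8FlatPortCurlCurlSupRowL0
import Summits.QuantumFields.YangMills.Theorems.UnitScaleTiltProp8FlatPortCurlCurlPairingL0
import Summits.QuantumFields.YangMills.Theorems.UnitScaleTiltProp8FlatPortColumnLetterL0
import Summits.QuantumFields.YangMills.Theorems.UnitScaleTiltProp8FlatPortBodyL0
import Summits.QuantumFields.YangMills.Theorems.UnitScaleTiltProp8FlatHDressingShape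
import Summits.QuantumFields.YangMills.Theorems.UnitScaleTiltProp8FlatCubeSequenceAdm
import HarnessLib

/-!
# Route `UnitScaleTilt`, crux K1 child «MinimiserStabilityRegPr» (stmt-QuantumFields-19200), registered stub V2′ `stub_halvingStep`
# (skeleton v10 `BirthV10`) — **THE DRESSING LETTER `C_E` AT THE CHART-`H` OF RECORD `H := flatH` (THE ♭ KNIT, FILE D)** — the M2 knit with its
# (X2) junction (✓ p608349 `HalvingDressingLetter.exists_hWq_dressed_cubeSeq_T3_of_columnLetters`, FILE C) READ AT THE KERNEL EXTENSION
# `𝔄_X(b) = Σ_c (flatH e_c)(b)•X(c)` OF P2's CANONICAL `H = GQ*(QGQ*)⁻¹`, with ALL FOUR H-SIDE SUPPLIER LETTERS — (46) `hH`, (X1) `hX1`, (X2-H) `hHcol`,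
# (X2-CH) `hCH` — DISCHARGED BY NAME at every admissible family of the P2 text (constants from `L` alone), so that the displayed residue of `C_E` is
# exactly the chart side: (55) `hD`, the chart's regularity near each sized field (`h49`, `hDd`, `hCd`), the (X2-C′) column letter `hCcol`, and numerics

Cell `ym3-torus` (HUMAN RULING D-0037, YM ladder rung R3 — continuum SU(2) YM₃ on the torus is a RUNG, not the Clay problem), width seat
`ym-ust-19200-w6` (D-0154 (3c); ★★OWNER ym3-torus-plan g26 RULING g26-№6 (S5)∕(S7), RULING g26-№7 (2): «H := `flatH` for the ♭ chart; (S6)∕FILE C knit — w6»).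
`--supports stmt-QuantumFields-19200 --as helper`; count-neutral; def-free, 0 sorry, standard axioms.

WHY.  Under RULING g26-№6 the H-side chart of record of the C_E node is print's double-bar functional on the Landau∕P1 coordinates, whose linearisation at
`0` is `η·Lʲ·Q_j` (✓ `ChartDoubleBarDefs`, CERT-2) and whose right inverse is therefore P2's flat `H = GQ*(QGQ*)⁻¹` ([Balaban1985Variational] (45), ✓ `FlatCubeOperators`);
the dressing letters consume `H` on 𝔤∕M₂-valued index data through the kernel extension.  Every H-side row FILE C displays is then a LANDED certificate:
(46) = the first entry `HSupLetterG … (flatH …) B₀` of P2's row list (✓ `FlatPortBodyL0.rowsAt_of_adm22`) read on matrix data by ✓ `FlatHDressingShape.hH_dressingShape_flatH`;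
(X1) = ✓ `FlatPortCurlCurlSupRowL0.curlCurlSupRow_of_adm22` read by ✓ `FlatHCurlCurlMatrix.matrix_curlCurlSupRow`; (X2-CH) = ✓ `FlatPortCurlCurlPairingL0.curlCurlPairing_of_adm22`
(index weight `η⁻³`, level-free) read by ✓ `FlatHCurlCurlMatrix.matrix_curlCurlPairing` (factor `2` from `‖tr(AB)‖ ≤ 2‖A‖‖B‖` on M₂); (X2-H) = ✓ `FlatPortColumnLetterL0.columnInputs_of_adm22`
(kernel majorant `k(b₋, c) ≥ |(flatH e_c)(b)|` with transposed column sum `Σ_b (w₃ b)⁻¹k(b₋, c) ≤ K₀η⁻³`) read by the triangle inequality (`l1Column_kernelExt` below).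

WHAT THIS FILE PROVES (sorry-free; no definition; `M₂ = Matrix (Fin 2) (Fin 2) ℂ` with the L²-operator norm; `η = L^{−(K−n)}`, `c = L^{K−n}`):
* §1 (bookkeeping, any finite index types) `exists_linearMap_kernelExt` — the kernel extension `X ↦ (b ↦ Σ_c (H₀ e_c)(b)•X c)` of a real operator `H₀` IS a ℂ-linear map
  (so FILE C's `H : _ →ₗ[ℂ] _` binder is inhabited at `flatH`, def-free, and every consumer presents its own packaging through the displayed `hHM`);
  ★ `l1Column_kernelExt` — (X2-H)ᴹ from a kernel majorant: `|(H₀ e_c)(b)| ≤ k(b, c)`, `Σ_b v(b)k(b, c) ≤ K(c)` ⟹ `Σ_b v(b)‖𝔄_X(b)‖ ≤ Σ_c K(c)‖X c‖`.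
* §2 ★★ **`hLetters_flatH_of_adm22`** — for odd `L = ℓ + 1 ≥ 5` there are `M_h⁰, R₀ : ℕ` and `B_H, C_X, K₀, C_P ≥ 0` (functions of `L` alone) such that at EVERY admissible
  datum of the P2 text (`m ≥ 1`, heights `1 ≤ K − n`, `K − n + 1 ≤ m + K`, big blocks `M = L·M_h`, `M_h = L^{a′} ≥ M_h⁰`, `R ≥ R₀`, `a′ + 3 ≤ m + n`, `D.k = K − n`,
  `Adm22 D R (L·M_h)`, level weights `IsLevWeight w`), for EVERY presentation `HM` of the kernel extension of `flatH F n K D` (`hHM`) and every index weight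
  `u ≥ η⁻³`: the four H-side binders of FILE C hold LITERALLY — (46) both rows unguarded (on a nonempty index set) with `B_H`; (X1) with `B_Δ := C_X`;
  (X2-H) `Σ_b (w₃ b)⁻¹‖HM X b‖ ≤ K₀·Σ_c u(c)‖X c‖`; (X2-CH) with `B_CH := 2C_P`.
* §3 ★★ **`exists_hWq_dressed_cubeSeq_T3_flatH`** — THE ♭ KNIT OF RECORD: FILE C's `exists_hWq_dressed_cubeSeq_T3_of_columnLetters` at the aligned cube sequence
  (144) `cubeSeqMT3 F n K x₀ ρ S (L·M_h)` (separation `R·(L·M_h) ≤ S`, `M_h = L^{a′} ≥ M_h⁰`, `R ≥ R₀`), P3b's `W₀` BY NAME (`a₀ = 1/(2L)`, `C₀ = 12L³(1428 + L)`),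
  `H` ANY ℂ-linear presentation of the kernel extension of `flatH` (`hHM`), the H-side letters DISCHARGED (§2 + ✓ `FlatCubeSequenceAdm.adm22_cubeSeqMT3`), displayed
  residue = `hD` (55), `h49`∕`hDd`∕`hCd` (the chart's (49) and differentiability near each sized field), `hCcol` (X2-C′) at the same index weight `u ≥ η⁻³`, and the
  numerics `C₃·R·K₀ ≤ ½`, `a₃ ≤ R₀ < R`, `(1 + 4B_HC₂R₀)a₃ ≤ 1/(2L)`; conclusion in the `hWq` binder shape of ✓ `HalvingA1Row165TraceAnyW.row165_of_tracePairing_L5_anyW` with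
  `C₄ = C₀θ² + 2C_XC₂ + 8C₃C_Pθ + 16K₀C₃R₀C₀θ²`, `θ = 1 + 4B_HC₂R₀` (the empty-index-set and `a₃ < 0` corner cases are handled inside the proof, no extra binder).
HONEST SCOPE.  Bookkeeping over landed certificates; nothing of the chart side ((55), (49), (72)∕(X2-C′), the analyticity rows — (S3) B2∕B3, (S4), (S6)) is proved here; the
one-step instantiation inherits `L ≥ 5` odd and `a′ + 3 ≤ m + n` (≥ `5L` big blocks per direction) from the port.  NOT a claim about the stub, the crux, the rung or the mass
gap; no summit statement is proved by this seat.

References: T. Bałaban, CMP **102** (1985) 277–309 [Balaban1985Variational] (45)–(46) p.285, (49) p.285, (55) p.286, (73) p.289, (80)–(89) pp.290–291, Prop. 4 (97)–(98)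
pp.292–293, (144) p.300, (157)–(158) p.302, (161)–(163) p.303; CMP **96** (1984) 223–250 [Balaban1984PropagatorsII] (2.1)–(2.4) p.224, Lemma 2.1 (2.61) p.234, Cor. 2.8
(2.150)–(2.151) p.249.
-/

set_option autoImplicit false

noncomputable section

open scoped BigOperators Matrix Matrix.Norms.L2Operator
open NormedSpace Filter Topology

namespace Summit.QuantumFields.YangMills.Theorems.HalvingDressingLetter

open Literature.MathematicalPhysics.QuantumFieldTheory.Balaban1983to89
open B6GlobalChartV1 (PV)
open B6SectADomainsV1 (Domains)
open B6SectAOperatorsV1 (BondIdx dcE dcsE)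
open T3ContinuumYM3Torus (T3Family)
open FlatCubeOpsText (Adm22 IsLevWeight HSupLetterG)
open FlatOpsLettersAssembly (flatH levWeight_nonneg)
open FlatCubeSequenceAligned (cubeSeqMT3 cubeSeqMT3_k)
open FlatCubeSequenceAdm (adm22_cubeSeqMT3)
open FlatProp4Bg1 (exists_gradient_weighted98_cubeSeq_T3)
open FlatPortBodyL0 (rowsAt_of_adm22)
open FlatPortCurlCurlSupRowL0 (curlCurlSupRow_of_adm22)
open FlatPortCurlCurlPairingL0 (curlCurlPairing_of_adm22)
open FlatPortColumnLetterL0 (columnInputs_of_adm22)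
open FlatHCurlCurlMatrix (matrix_curlCurlSupRow matrix_curlCurlPairing)
open FlatHDressingShape (hH_dressingShape_flatH)

/-! ## §1 The kernel extension of a real operator on matrix-valued index data -/

section KernelExt

variable {ι κ : Type*} [Fintype ι] [DecidableEq ι] {N : ℕ}

/-- **THE KERNEL EXTENSION IS ℂ-LINEAR**: for a real operator `H₀` on finitely supported index data, `X ↦ (b ↦ Σ_c (H₀ e_c)(b)•X c)` is (the coercion of) a ℂ-linear map
on `M_N(ℂ)`-valued data — so letters stated for `H : _ →ₗ[ℂ] _` with the display `hHM : ∀ X b, H X b = Σ_c (H₀ e_c)(b)•X c` (FILE C, ★w3-19936 g4's (X1)ᴹ∕(X2-CH)ᴹ) are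
inhabited at every real `H₀`, in particular at P2's `flatH`. [cite: Balaban1985Variational, (45)-(46) p.285, (157) p.302] -/
theorem exists_linearMap_kernelExt (H₀ : (ι → ℝ) →ₗ[ℝ] (κ → ℝ)) :
    ∃ HM : (ι → Matrix (Fin N) (Fin N) ℂ) →ₗ[ℂ] (κ → Matrix (Fin N) (Fin N) ℂ),
      ∀ (X : ι → Matrix (Fin N) (Fin N) ℂ) (b : κ), HM X b = ∑ c, H₀ (Pi.single c 1) b • X c := by
  refine ⟨{ toFun := fun X b => ∑ c, H₀ (Pi.single c 1) b • X c
            map_add' := fun X X' => ?_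
            map_smul' := fun a X => ?_ }, fun X b => rfl⟩
  · funext b
    show ∑ c, H₀ (Pi.single c 1) b • (X + X') c = (∑ c, H₀ (Pi.single c 1) b • X c) + ∑ c, H₀ (Pi.single c 1) b • X' c
    simp only [Pi.add_apply, smul_add, Finset.sum_add_distrib]
  · funext b
    show ∑ c, H₀ (Pi.single c 1) b • (a • X) c = a • ∑ c, H₀ (Pi.single c 1) b • X c
    rw [Finset.smul_sum]
    exact Finset.sum_congr rfl fun c _ => by rw [Pi.smul_apply, smul_comm]

/-- ★ **(X2-H)ᴹ FROM A KERNEL MAJORANT** (the triangle inequality, summed): if `|(H₀ e_c)(b)| ≤ k(b, c)` and the weighted transposed column sums obey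
`Σ_b v(b)·k(b, c) ≤ K(c)` (`v ≥ 0`), then every presentation `HM` of the kernel extension satisfies `Σ_b v(b)·‖HM X b‖ ≤ Σ_c K(c)·‖X c‖` — the `hHcol` binder of the M2 knit
read from ✓ `FlatPortColumnLetterL0.columnInputs_of_adm22`'s `(hK, hcol)`. [cite: Balaban1985Variational, (46) p.285, (161)-(163) p.303; Balaban1984PropagatorsII, Lemma 2.1 (2.61) p.234] -/
theorem l1Column_kernelExt [Fintype κ] (H₀ : (ι → ℝ) →ₗ[ℝ] (κ → ℝ)) (v : κ → ℝ) (hv : ∀ b, 0 ≤ v b)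
    (k : κ → ι → ℝ) (hK : ∀ c b, |H₀ (Pi.single c 1) b| ≤ k b c) (Kc : ι → ℝ) (hcol : ∀ c, ∑ b, v b * k b c ≤ Kc c)
    (HM : (ι → Matrix (Fin N) (Fin N) ℂ) → κ → Matrix (Fin N) (Fin N) ℂ) (hHM : ∀ X b, HM X b = ∑ c, H₀ (Pi.single c 1) b • X c)
    (X : ι → Matrix (Fin N) (Fin N) ℂ) : ∑ b, v b * ‖HM X b‖ ≤ ∑ c, Kc c * ‖X c‖ := by
  have h1 : ∀ b, ‖HM X b‖ ≤ ∑ c, k b c * ‖X c‖ := fun b => by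
    rw [hHM]
    refine (norm_sum_le _ _).trans (Finset.sum_le_sum fun c _ => ?_)
    rw [norm_smul, Real.norm_eq_abs]
    exact mul_le_mul_of_nonneg_right (hK c b) (norm_nonneg _)
  calc ∑ b, v b * ‖HM X b‖ ≤ ∑ b, v b * ∑ c, k b c * ‖X c‖ :=
        Finset.sum_le_sum fun b _ => mul_le_mul_of_nonneg_left (h1 b) (hv b)
    _ = ∑ c, (∑ b, v b * k b c) * ‖X c‖ := by
        simp_rw [Finset.mul_sum, Finset.sum_mul]
        rw [Finset.sum_comm]
        exact Finset.sum_congr rfl fun c _ => Finset.sum_congr rfl fun b _ => by ring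
    _ ≤ ∑ c, Kc c * ‖X c‖ := Finset.sum_le_sum fun c _ => mul_le_mul_of_nonneg_right (hcol c) (norm_nonneg _)

end KernelExt

/-! ## §2 The four H-side letters of FILE C for `flatH`, at every admissible family of the P2 text -/

/-- `1 ≤ 3` (named once; every `PV` below carries the same proof term). [folklore] -/
private theorem hd3 : 1 ≤ 2 + 1 := by norm_num

/-- ★★ **THE FOUR H-SIDE LETTERS OF THE DRESSING KNIT AT `H := flatH`, EVERY ADMISSIBLE FAMILY, CONSTANTS FROM `L` ALONE**: for odd `L = ℓ + 1 ≥ 5` there are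
`M_h⁰, R₀` and `B_H, C_X, K₀, C_P ≥ 0` such that at every admissible datum of the P2 text (the binders of ✓ `FlatPortBodyL0.rowsAt_of_adm22`) and for every
presentation `HM X b = Σ_c (flatH e_c)(b)•X c` of the kernel extension on M₂-valued index data and every index weight `u ≥ η⁻³` (`η⁻¹ = L^{K−n}`):
(46)ᴹ both rows, unguarded on a nonempty index set (✓ `hH_dressingShape_flatH` ∘ `rowsAt_of_adm22`) — FILE C's `hH`; (X1)ᴹ (✓ `matrix_curlCurlSupRow` ∘
`curlCurlSupRow_of_adm22`) — FILE C's `hX1` with `B_Δ := C_X`; (X2-H)ᴹ (§1 ∘ ✓ `columnInputs_of_adm22`) — FILE C's `hHcol` with `h₁ := K₀`; (X2-CH)ᴹ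
(✓ `matrix_curlCurlPairing` ∘ `curlCurlPairing_of_adm22`) — FILE C's `hCH` with `B_CH := 2C_P`.
[cite: Balaban1985Variational, (45)-(46) p.285, (88) p.291, (157) p.302, (161)-(163) p.303; Balaban1984PropagatorsII, (2.1)-(2.4) p.224, Lemma 2.1 (2.61) p.234, Cor. 2.8 (2.150)-(2.151) p.249] -/
theorem hLetters_flatH_of_adm22 (ℓ : ℕ) (hL : Odd (ℓ + 1) ∧ 1 < ℓ + 1) (hℓ : 4 ≤ ℓ) :
    ∃ (Mh₀ R₀ : ℕ) (BH CX K₀ CP : ℝ), 0 ≤ BH ∧ 0 ≤ CX ∧ 0 ≤ K₀ ∧ 0 ≤ CP ∧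
    ∀ (m : ℕ) (hm : 1 ≤ m) (n K : ℕ) (_ : 1 ≤ K - n) (_ : K - n + 1 ≤ m + K) {Mh R a' : ℕ} (_ : Mh = (ℓ + 1) ^ a') (_ : Mh₀ ≤ Mh) (_ : R₀ ≤ R)
      (_ : a' + 3 ≤ m + n) (D : Domains (PV 2 ℓ m K hd3 hL)) (_ : D.k = K - n) (_ : Adm22 D R ((ℓ + 1) * Mh))
      (w : ℕ → PBond (PV 2 ℓ m K hd3 hL) 0 → ℝ) (_ : IsLevWeight (⟨ℓ + 1, hL, m, hm⟩ : T3Family) n K D w)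
      (HM : (BondIdx D → Matrix (Fin 2) (Fin 2) ℂ) → PBond (PV 2 ℓ m K hd3 hL) 0 → Matrix (Fin 2) (Fin 2) ℂ)
      (_ : ∀ (X : BondIdx D → Matrix (Fin 2) (Fin 2) ℂ) (b : PBond (PV 2 ℓ m K hd3 hL) 0),
        HM X b = ∑ c : BondIdx D, flatH (⟨ℓ + 1, hL, m, hm⟩ : T3Family) n K D (Pi.single c 1) b • X c)
      (u : BondIdx D → ℝ) (_ : ∀ c, ((((ℓ + 1 : ℕ) : ℝ)) ^ (K - n)) ^ 3 ≤ u c),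
      (Nonempty (BondIdx D) → ∀ (X : BondIdx D → Matrix (Fin 2) (Fin 2) ℂ) (t : ℝ), (∀ c, ‖X c‖ ≤ t) →
        (∀ b, w 1 b * ‖HM X b‖ ≤ BH * t) ∧
        ∀ (b : PBond (PV 2 ℓ m K hd3 hL) 0) (ν : Fin 3),
          w 2 b * ((ℓ + 1 : ℕ) : ℝ) ^ (K - n) * ‖HM X ⟨b.src.shift ν, b.dir⟩ - HM X b‖ ≤ BH * t) ∧
      (∀ (X : BondIdx D → Matrix (Fin 2) (Fin 2) ℂ) (t : ℝ), 0 ≤ t → (∀ c, ‖X c‖ ≤ t) → ∀ b : PBond (PV 2 ℓ m K hd3 hL) 0,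
        w 3 b * ‖((((((((ℓ + 1 : ℕ) : ℝ)⁻¹) ^ (K - n)) : ℝ) : ℂ) ^ 2)⁻¹ • ∑ p : Plaq (PV 2 ℓ m K hd3 hL) 0,
          ((Pi.single b (1 : ℂ) : PBond (PV 2 ℓ m K hd3 hL) 0 → ℂ) ⟨p.src, p.μ⟩ + (Pi.single b (1 : ℂ) : PBond (PV 2 ℓ m K hd3 hL) 0 → ℂ) ⟨p.src.shift p.μ, p.ν⟩ -
              (Pi.single b (1 : ℂ) : PBond (PV 2 ℓ m K hd3 hL) 0 → ℂ) ⟨p.src.shift p.ν, p.μ⟩ - (Pi.single b (1 : ℂ) : PBond (PV 2 ℓ m K hd3 hL) 0 → ℂ) ⟨p.src, p.ν⟩) •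
            (HM X ⟨p.src, p.μ⟩ + HM X ⟨p.src.shift p.μ, p.ν⟩ - HM X ⟨p.src.shift p.ν, p.μ⟩ - HM X ⟨p.src, p.ν⟩))‖ ≤ CX * t) ∧
      (∀ X : BondIdx D → Matrix (Fin 2) (Fin 2) ℂ, ∑ b, (w 3 b)⁻¹ * ‖HM X b‖ ≤ K₀ * ∑ c, u c * ‖X c‖) ∧
      (∀ (Z : PBond (PV 2 ℓ m K hd3 hL) 0 → Matrix (Fin 2) (Fin 2) ℂ) (s : ℝ), 0 ≤ s → (∀ b, w 1 b * ‖Z b‖ ≤ s) →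
        (∀ (b : PBond (PV 2 ℓ m K hd3 hL) 0) (ν : Fin 3), w 2 b * ((ℓ + 1 : ℕ) : ℝ) ^ (K - n) * ‖Z ⟨b.src.shift ν, b.dir⟩ - Z b‖ ≤ s) →
        ∀ X : BondIdx D → Matrix (Fin 2) (Fin 2) ℂ,
          ‖∑ b, Matrix.trace (((((((((ℓ + 1 : ℕ) : ℝ)⁻¹) ^ (K - n)) : ℝ) : ℂ) ^ 2)⁻¹ • ∑ p : Plaq (PV 2 ℓ m K hd3 hL) 0,
            ((Pi.single b (1 : ℂ) : PBond (PV 2 ℓ m K hd3 hL) 0 → ℂ) ⟨p.src, p.μ⟩ + (Pi.single b (1 : ℂ) : PBond (PV 2 ℓ m K hd3 hL) 0 → ℂ) ⟨p.src.shift p.μ, p.ν⟩ -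
                (Pi.single b (1 : ℂ) : PBond (PV 2 ℓ m K hd3 hL) 0 → ℂ) ⟨p.src.shift p.ν, p.μ⟩ - (Pi.single b (1 : ℂ) : PBond (PV 2 ℓ m K hd3 hL) 0 → ℂ) ⟨p.src, p.ν⟩) •
              (HM X ⟨p.src, p.μ⟩ + HM X ⟨p.src.shift p.μ, p.ν⟩ - HM X ⟨p.src.shift p.ν, p.μ⟩ - HM X ⟨p.src, p.ν⟩)) * Z b)‖ ≤
            2 * CP * s * ∑ c, u c * ‖X c‖) := by
  obtain ⟨Mh₁, R₁, C, δ₀, B₃, CG, hC, -, -, -, hrows⟩ := rowsAt_of_adm22 ℓ hL hℓ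
  obtain ⟨Mh₂, R₂, CX, hCX, hX1s⟩ := curlCurlSupRow_of_adm22 ℓ hL hℓ
  obtain ⟨Mh₃, R₃, K₀, hK₀, hcols⟩ := columnInputs_of_adm22 ℓ hL hℓ
  obtain ⟨Mh₄, R₄, CP, hCP, hpair⟩ := curlCurlPairing_of_adm22 ℓ hL hℓ
  refine ⟨max (max Mh₁ Mh₂) (max Mh₃ Mh₄), max (max R₁ R₂) (max R₃ R₄), max C (C * B₃), CX, K₀, CP,
    le_max_of_le_left hC, hCX, hK₀, hCP, ?_⟩
  intro m hm n K hk1 hk' Mh R a' hMha hMh hR hsize D hDk hAdm w hw HM hHM u hu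
  -- thresholds of the four suppliers
  have hMh₁ : Mh₁ ≤ Mh := le_trans (le_trans (le_max_left _ _) (le_max_left _ _)) hMh
  have hMh₂ : Mh₂ ≤ Mh := le_trans (le_trans (le_max_right _ _) (le_max_left _ _)) hMh
  have hMh₃ : Mh₃ ≤ Mh := le_trans (le_trans (le_max_left _ _) (le_max_right _ _)) hMh
  have hMh₄ : Mh₄ ≤ Mh := le_trans (le_trans (le_max_right _ _) (le_max_right _ _)) hMh
  have hR₁ : R₁ ≤ R := le_trans (le_trans (le_max_left _ _) (le_max_left _ _)) hR
  have hR₂ : R₂ ≤ R := le_trans (le_trans (le_max_right _ _) (le_max_left _ _)) hR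
  have hR₃ : R₃ ≤ R := le_trans (le_trans (le_max_left _ _) (le_max_right _ _)) hR
  have hR₄ : R₄ ≤ R := le_trans (le_trans (le_max_right _ _) (le_max_right _ _)) hR
  -- the carrier's positivities
  have hL0 : (0 : ℝ) < ((ℓ + 1 : ℕ) : ℝ) := by positivity
  have hη3 : 0 ≤ ((((ℓ + 1 : ℕ) : ℝ)) ^ (K - n)) ^ 3 := by positivity
  have hu0 : ∀ c, 0 ≤ u c := fun c => hη3.trans (hu c)
  have hw3 : ∀ b, 0 < w 3 b := fun b => by
    rw [hw 3 b]
    exact pow_pos (mul_pos (pow_pos hL0 _) (pow_pos (inv_pos.2 hL0) _)) 3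
  have hw2 : ∀ b, 0 ≤ w 2 b := fun b => levWeight_nonneg hw 2 b
  have hDk' : D.k ≤ K - n := hDk.le
  refine ⟨fun hne => ?_, ?_, ?_, ?_⟩
  · -- (46)ᴹ: the first entry of P2's row list, read on matrix data
    have hsup : HSupLetterG (⟨ℓ + 1, hL, m, hm⟩ : T3Family) n K D w (flatH (⟨ℓ + 1, hL, m, hm⟩ : T3Family) n K D) (max C (C * B₃)) :=
      (hrows m hm n K hk1 hk' hMha hMh₁ hR₁ hsize D hDk hAdm w hw).1.1
    exact hH_dressingShape_flatH (⟨ℓ + 1, hL, m, hm⟩ : T3Family) n K D hDk' w hw hsup hne HM hHM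
  · -- (X1)ᴹ
    exact matrix_curlCurlSupRow (F := (⟨ℓ + 1, hL, m, hm⟩ : T3Family)) (n := n) (K := K) (D := D) (w := w)
      (H := flatH (⟨ℓ + 1, hL, m, hm⟩ : T3Family) n K D) hCX hw3 (hX1s m hm n K hk1 hk' hMha hMh₂ hR₂ hsize D hDk hAdm w hw) HM hHM
  · -- (X2-H)ᴹ
    intro X
    obtain ⟨ks, -, hK, -, hcol⟩ := hcols m hm n K hk1 hk' hMha hMh₃ hR₃ hsize D hDk hAdm w hw
    have hw3i : ∀ b, 0 ≤ (w 3 b)⁻¹ := fun b => (inv_pos.2 (hw3 b)).le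
    have hinv : (((((ℓ + 1 : ℕ) : ℝ))⁻¹) ^ (K - n))⁻¹ = (((ℓ + 1 : ℕ) : ℝ)) ^ (K - n) := by rw [inv_pow, inv_inv]
    have h := l1Column_kernelExt (ι := BondIdx D) (κ := PBond (PV 2 ℓ m K hd3 hL) 0) (flatH (⟨ℓ + 1, hL, m, hm⟩ : T3Family) n K D)
      (fun b => (w 3 b)⁻¹) hw3i (fun b c => ks b.src c) hK
      (fun _ => K₀ * (((((ℓ + 1 : ℕ) : ℝ))⁻¹) ^ (K - n))⁻¹ ^ 3) hcol HM hHM X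
    calc ∑ b, (w 3 b)⁻¹ * ‖HM X b‖ ≤ ∑ c, K₀ * (((((ℓ + 1 : ℕ) : ℝ))⁻¹) ^ (K - n))⁻¹ ^ 3 * ‖X c‖ := h
      _ ≤ ∑ c, K₀ * u c * ‖X c‖ := Finset.sum_le_sum fun c _ =>
          mul_le_mul_of_nonneg_right (mul_le_mul_of_nonneg_left (by rw [hinv]; exact hu c) hK₀) (norm_nonneg _)
      _ = K₀ * ∑ c, u c * ‖X c‖ := by rw [Finset.mul_sum]; exact Finset.sum_congr rfl fun c _ => by ring
  · -- (X2-CH)ᴹ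
    intro Z s hs _ hZ X
    have hsc : ∀ (Zr : PBond (PV 2 ℓ m K hd3 hL) 0 → ℝ) (s' : ℝ), 0 ≤ s' →
        (∀ (b : PBond (PV 2 ℓ m K hd3 hL) 0) (ν : Fin (2 + 1)),
          w 2 b * ((ℓ + 1 : ℕ) : ℝ) ^ (K - n) * |Zr ⟨b.src.shift ν, b.dir⟩ - Zr b| ≤ s') →
        ∀ Y : BondIdx D → ℝ,
          |∑ b : PBond (PV 2 ℓ m K hd3 hL) 0, (dcsE ((((ℓ + 1 : ℕ) : ℝ)) ^ (K - n)) (dcE ((((ℓ + 1 : ℕ) : ℝ)) ^ (K - n))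
            (WithLp.toLp 2 (flatH (⟨ℓ + 1, hL, m, hm⟩ : T3Family) n K D Y)))) b * Zr b| ≤ CP * s' * ∑ c, u c * |Y c| := by
      intro Zr s' hs' hZr Y
      have h := hpair m hm n K hk1 hk' hMha hMh₄ hR₄ hsize D hDk hAdm w hw Zr s' hs' hZr Y
      calc _ ≤ CP * ((((ℓ + 1 : ℕ) : ℝ)) ^ (K - n)) ^ 3 * s' * ∑ c, |Y c| := h
        _ = CP * s' * ∑ c, ((((ℓ + 1 : ℕ) : ℝ)) ^ (K - n)) ^ 3 * |Y c| := by
            rw [Finset.mul_sum, Finset.mul_sum]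
            exact Finset.sum_congr rfl fun c _ => by ring
        _ ≤ CP * s' * ∑ c, u c * |Y c| :=
            mul_le_mul_of_nonneg_left (Finset.sum_le_sum fun c _ => mul_le_mul_of_nonneg_right (hu c) (abs_nonneg _))
              (mul_nonneg hCP hs')
    exact matrix_curlCurlPairing (F := (⟨ℓ + 1, hL, m, hm⟩ : T3Family)) (n := n) (K := K) (D := D) (w := w)
      (H := flatH (⟨ℓ + 1, hL, m, hm⟩ : T3Family) n K D) hCP hu0 hw2 hsc HM hHM Z s hs hZ X

/-! ## §3 The ♭ knit of record: FILE C at the aligned cube sequence with `H := flatH`'s kernel extension -/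

/-- ★★ **THE DRESSING LETTER `C_E` AT THE CHART-`H` OF RECORD (`H := flatH`), ALIGNED CUBE SEQUENCE (144), P3b's `W₀` BY NAME** — FILE C's
`exists_hWq_dressed_cubeSeq_T3_of_columnLetters` with the four H-side letters DISCHARGED (§2 at the family `cubeSeqMT3 F n K x₀ ρ S (L·M_h)`, admissible by
✓ `adm22_cubeSeqMT3` under the separation `R·(L·M_h) ≤ S`): for odd `L = ℓ + 1 ≥ 5` there are `M_h⁰, R₀` and `B_H, C_X, K₀, C_P ≥ 0` (from `L` alone) such that for
every member `F = ⟨L, m⟩`, heights `1 ≤ K − n`, `K − n + 1 ≤ m + K`, `M_h = L^{a′} ≥ M_h⁰`, `R ≥ R₀`, `a′ + 3 ≤ m + n`, centre `x₀`, radii `ρ`, `S ≥ R·(L·M_h)`, level weights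
`w`, EVERY ℂ-linear presentation `H` of the kernel extension of `flatH` (`hHM`), every index weight `u ≥ η⁻³`, and every chart datum `(C, D)` with (55) `hD` (`4C₂r²`
below `R_c`), the regularity rows `h49`∕`hDd`∕`hCd` below `R_c`, the (X2-C′) column letter `hCcol` (slope `C₃·r`), and the numerics `C₃R_cK₀ ≤ ½`, `a₃ ≤ R_c⁰ < R_c`,
`(1 + 4B_HC₂R_c⁰)a₃ ≤ 1/(2L)`: there is `W₀` (P3b's: the (grad) identity for `𝒱_η`, entire) such that for the EXPLICIT dressing term `E` of this `W₀` (`hE` verbatim)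
`w₃(b)·‖(W₀(Y − H(D Y)) + E Y)(b)‖ ≤ C₄·r²` for all `Y` of size `r < a₃` — `C₄ = C₀θ² + 2C_XC₂ + ½(8C₃(2C_P))θ + 16K₀C₃R_c⁰C₀θ²`, `C₀ = 12L³(1428 + L)`,
`θ = 1 + 4B_HC₂R_c⁰` — EXACTLY the `hWq` binder of ✓ `row165_of_tracePairing_L5_anyW` for the dressed current.
[cite: Balaban1985Variational, (45)-(46) p.285, (49) p.285, (55) p.286, (73) p.289, (80)-(89) pp.290-291, Prop. 4 (97)-(98) pp.292-293, (144) p.300, (157)-(158) p.302, (161)-(163) p.303] -/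
theorem exists_hWq_dressed_cubeSeq_T3_flatH (ℓ : ℕ) (hL : Odd (ℓ + 1) ∧ 1 < ℓ + 1) (hℓ : 4 ≤ ℓ) :
    ∃ (Mh₀ R₀ : ℕ) (BH CX K₀ CP : ℝ), 0 ≤ BH ∧ 0 ≤ CX ∧ 0 ≤ K₀ ∧ 0 ≤ CP ∧
    ∀ (m : ℕ) (hm : 1 ≤ m) (n K : ℕ) (_ : 1 ≤ K - n) (_ : K - n + 1 ≤ m + K) {Mh R a' : ℕ} (_ : Mh = (ℓ + 1) ^ a') (_ : Mh₀ ≤ Mh) (_ : R₀ ≤ R)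
      (_ : a' + 3 ≤ m + n) (x₀ : Site (PV 2 ℓ m K hd3 hL) 0) (ρ S : ℕ) (hM : 1 ≤ (ℓ + 1) * Mh) (_ : R * ((ℓ + 1) * Mh) ≤ S)
      (w : ℕ → PBond (PV 2 ℓ m K hd3 hL) 0 → ℝ)
      (_ : IsLevWeight (⟨ℓ + 1, hL, m, hm⟩ : T3Family) n K (cubeSeqMT3 (⟨ℓ + 1, hL, m, hm⟩ : T3Family) n K x₀ ρ S ((ℓ + 1) * Mh) hM) w)
      (H : (BondIdx (cubeSeqMT3 (⟨ℓ + 1, hL, m, hm⟩ : T3Family) n K x₀ ρ S ((ℓ + 1) * Mh) hM) → Matrix (Fin 2) (Fin 2) ℂ) →ₗ[ℂ]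
        (PBond (PV 2 ℓ m K hd3 hL) 0 → Matrix (Fin 2) (Fin 2) ℂ))
      (_ : ∀ (X : BondIdx (cubeSeqMT3 (⟨ℓ + 1, hL, m, hm⟩ : T3Family) n K x₀ ρ S ((ℓ + 1) * Mh) hM) → Matrix (Fin 2) (Fin 2) ℂ)
        (b : PBond (PV 2 ℓ m K hd3 hL) 0),
        H X b = ∑ c : BondIdx (cubeSeqMT3 (⟨ℓ + 1, hL, m, hm⟩ : T3Family) n K x₀ ρ S ((ℓ + 1) * Mh) hM),
          flatH (⟨ℓ + 1, hL, m, hm⟩ : T3Family) n K (cubeSeqMT3 (⟨ℓ + 1, hL, m, hm⟩ : T3Family) n K x₀ ρ S ((ℓ + 1) * Mh) hM) (Pi.single c 1) b • X c)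
      (u : BondIdx (cubeSeqMT3 (⟨ℓ + 1, hL, m, hm⟩ : T3Family) n K x₀ ρ S ((ℓ + 1) * Mh) hM) → ℝ) (_ : ∀ c, ((((ℓ + 1 : ℕ) : ℝ)) ^ (K - n)) ^ 3 ≤ u c)
      (C D : (PBond (PV 2 ℓ m K hd3 hL) 0 → Matrix (Fin 2) (Fin 2) ℂ) →
        (BondIdx (cubeSeqMT3 (⟨ℓ + 1, hL, m, hm⟩ : T3Family) n K x₀ ρ S ((ℓ + 1) * Mh) hM) → Matrix (Fin 2) (Fin 2) ℂ))
      {C₂ Rc Rc₀ a₃ C₃ : ℝ}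
      (_ : ∀ (Y : PBond (PV 2 ℓ m K hd3 hL) 0 → Matrix (Fin 2) (Fin 2) ℂ) (r' : ℝ), r' < Rc → (∀ b, w 1 b * ‖Y b‖ ≤ r') →
        (∀ (b : PBond (PV 2 ℓ m K hd3 hL) 0) (ν : Fin 3), w 2 b * ((ℓ + 1 : ℕ) : ℝ) ^ (K - n) * ‖Y ⟨b.src.shift ν, b.dir⟩ - Y b‖ ≤ r') →
        ∀ c', ‖D Y c'‖ ≤ 4 * C₂ * r' ^ 2)
      (_ : ∀ (Y : PBond (PV 2 ℓ m K hd3 hL) 0 → Matrix (Fin 2) (Fin 2) ℂ) (r : ℝ), r < Rc → (∀ b, w 1 b * ‖Y b‖ ≤ r) →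
        (∀ (b : PBond (PV 2 ℓ m K hd3 hL) 0) (ν : Fin 3), w 2 b * ((ℓ + 1 : ℕ) : ℝ) ^ (K - n) * ‖Y ⟨b.src.shift ν, b.dir⟩ - Y b‖ ≤ r) →
        ∀ᶠ X in 𝓝 Y, D X = C (X - H (D X)))
      (_ : ∀ (Y : PBond (PV 2 ℓ m K hd3 hL) 0 → Matrix (Fin 2) (Fin 2) ℂ) (r : ℝ), r < Rc → (∀ b, w 1 b * ‖Y b‖ ≤ r) →
        (∀ (b : PBond (PV 2 ℓ m K hd3 hL) 0) (ν : Fin 3), w 2 b * ((ℓ + 1 : ℕ) : ℝ) ^ (K - n) * ‖Y ⟨b.src.shift ν, b.dir⟩ - Y b‖ ≤ r) →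
        DifferentiableAt ℂ D Y)
      (_ : ∀ (Y : PBond (PV 2 ℓ m K hd3 hL) 0 → Matrix (Fin 2) (Fin 2) ℂ) (r : ℝ), r < Rc → (∀ b, w 1 b * ‖Y b‖ ≤ r) →
        (∀ (b : PBond (PV 2 ℓ m K hd3 hL) 0) (ν : Fin 3), w 2 b * ((ℓ + 1 : ℕ) : ℝ) ^ (K - n) * ‖Y ⟨b.src.shift ν, b.dir⟩ - Y b‖ ≤ r) →
        DifferentiableAt ℂ C (Y - H (D Y)))
      (_ : ∀ (Y : PBond (PV 2 ℓ m K hd3 hL) 0 → Matrix (Fin 2) (Fin 2) ℂ) (r : ℝ), r < Rc → (∀ b, w 1 b * ‖Y b‖ ≤ r) →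
        (∀ (b : PBond (PV 2 ℓ m K hd3 hL) 0) (ν : Fin 3), w 2 b * ((ℓ + 1 : ℕ) : ℝ) ^ (K - n) * ‖Y ⟨b.src.shift ν, b.dir⟩ - Y b‖ ≤ r) →
        ∀ δ : PBond (PV 2 ℓ m K hd3 hL) 0 → Matrix (Fin 2) (Fin 2) ℂ,
          ∑ c', u c' * ‖fderiv ℂ C (Y - H (D Y)) δ c'‖ ≤ C₃ * r * ∑ b, (w 3 b)⁻¹ * ‖δ b‖)
      (_ : C₃ * Rc * K₀ ≤ 1 / 2) (_ : 0 ≤ C₃) (_ : 0 ≤ C₂) (_ : 0 ≤ Rc₀) (_ : Rc₀ < Rc) (_ : a₃ ≤ Rc₀)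
      (_ : (1 + 4 * BH * C₂ * Rc₀) * a₃ ≤ 1 / (2 * ((ℓ + 1 : ℕ) : ℝ))),
    ∃ W₀ : (PBond (PV 2 ℓ m K hd3 hL) 0 → Matrix (Fin 2) (Fin 2) ℂ) → (PBond (PV 2 ℓ m K hd3 hL) 0 → Matrix (Fin 2) (Fin 2) ℂ),
      (∀ A δ : PBond (PV 2 ℓ m K hd3 hL) 0 → Matrix (Fin 2) (Fin 2) ℂ, fderiv ℂ (fun A : PBond (PV 2 ℓ m K hd3 hL) 0 → Matrix (Fin 2) (Fin 2) ℂ => (∑ p : Plaq (PV 2 ℓ m K hd3 hL) 0, (1 - (2 : ℂ)⁻¹ * Matrix.trace (exp ((Complex.I * ((((((ℓ + 1 : ℕ) : ℝ)⁻¹) ^ (K - n) : ℝ)) : ℂ)) • A ⟨p.src, p.μ⟩) * exp ((Complex.I * ((((((ℓ + 1 : ℕ) : ℝ)⁻¹) ^ (K - n) : ℝ)) : ℂ)) • A ⟨p.src.shift p.μ, p.ν⟩) * exp (-((Complex.I * ((((((ℓ + 1 : ℕ) : ℝ)⁻¹) ^ (K - n) : ℝ)) : ℂ)) • A ⟨p.src.shift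 p.ν, p.μ⟩)) * exp (-((Complex.I * ((((((ℓ + 1 : ℕ) : ℝ)⁻¹) ^ (K - n) : ℝ)) : ℂ)) • A ⟨p.src, p.ν⟩))) + (2 : ℂ)⁻¹ * Matrix.trace (((Complex.I * ((((((ℓ + 1 : ℕ) : ℝ)⁻¹) ^ (K - n) : ℝ)) : ℂ)) • A ⟨p.src, p.μ⟩) + ((Complex.I * ((((((ℓ + 1 : ℕ) : ℝ)⁻¹) ^ (K - n) : ℝ)) : ℂ)) • A ⟨p.src.shift p.μ, p.ν⟩) + (-((Complex.I * ((((((ℓ + 1 : ℕ) : ℝ)⁻¹) ^ (K - n) : ℝ)) : ℂ)) • A ⟨p.src.shift p.ν, p.μ⟩)) + (-((Complex.I * ((((((ℓ + 1 : ℕ) : ℝ)⁻¹) ^ (K - n) : ℝ)) : ℂ)) • A ⟨p.src, p.ν⟩))) + (4 : ℂ)⁻¹ * Matrix.trace ((((Complex.I * ((((((ℓ + 1 : ℕ) : ℝ)⁻¹) ^ (K - n) : ℝ)) : ℂ)) • A ⟨p.src, p.μ⟩) + ((Complex.I * ((((((ℓ + 1 : ℕ) : ℝ)⁻¹) ^ (K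 - n) : ℝ)) : ℂ)) • A ⟨p.src.shift p.μ, p.ν⟩) + (-((Complex.I * ((((((ℓ + 1 : ℕ) : ℝ)⁻¹) ^ (K - n) : ℝ)) : ℂ)) • A ⟨p.src.shift p.ν, p.μ⟩)) + (-((Complex.I * ((((((ℓ + 1 : ℕ) : ℝ)⁻¹) ^ (K - n) : ℝ)) : ℂ)) • A ⟨p.src, p.ν⟩))) ^ 2)))) A δ =
        (((((ℓ + 1 : ℕ) : ℝ)⁻¹) ^ (K - n) : ℝ) : ℂ) ^ 4 * ∑ b : PBond (PV 2 ℓ m K hd3 hL) 0, Matrix.trace (W₀ A b * δ b)) ∧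
      Differentiable ℂ W₀ ∧
      ∀ E : (PBond (PV 2 ℓ m K hd3 hL) 0 → Matrix (Fin 2) (Fin 2) ℂ) → (PBond (PV 2 ℓ m K hd3 hL) 0 → Matrix (Fin 2) (Fin 2) ℂ),
        (∀ (Y : PBond (PV 2 ℓ m K hd3 hL) 0 → Matrix (Fin 2) (Fin 2) ℂ) (b : PBond (PV 2 ℓ m K hd3 hL) 0) (i j : Fin 2), E Y b i j = (((((((ℓ + 1 : ℕ) : ℝ)⁻¹) ^ (K - n)) : ℝ) : ℂ) ^ 4)⁻¹ *
          (-((((((((ℓ + 1 : ℕ) : ℝ)⁻¹) ^ (K - n)) : ℝ) : ℂ) ^ 2 / 2) * ∑ p : Plaq (PV 2 ℓ m K hd3 hL) 0, Matrix.trace ((H (D Y) ⟨p.src, p.μ⟩ + H (D Y) ⟨p.src.shift p.μ, p.ν⟩ - H (D Y) ⟨p.src.shift p.ν, p.μ⟩ - H (D Y) ⟨p.src, p.ν⟩) *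
              (((Pi.single b (Matrix.single j i (1 : ℂ)) : PBond (PV 2 ℓ m K hd3 hL) 0 → Matrix (Fin 2) (Fin 2) ℂ)) ⟨p.src, p.μ⟩ + ((Pi.single b (Matrix.single j i (1 : ℂ)) : PBond (PV 2 ℓ m K hd3 hL) 0 → Matrix (Fin 2) (Fin 2) ℂ)) ⟨p.src.shift p.μ, p.ν⟩ -
                ((Pi.single b (Matrix.single j i (1 : ℂ)) : PBond (PV 2 ℓ m K hd3 hL) 0 → Matrix (Fin 2) (Fin 2) ℂ)) ⟨p.src.shift p.ν, p.μ⟩ - ((Pi.single b (Matrix.single j i (1 : ℂ)) : PBond (PV 2 ℓ m K hd3 hL) 0 → Matrix (Fin 2) (Fin 2) ℂ)) ⟨p.src, p.ν⟩)))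
            - (((((((ℓ + 1 : ℕ) : ℝ)⁻¹) ^ (K - n)) : ℝ) : ℂ) ^ 2 / 2) * ∑ p : Plaq (PV 2 ℓ m K hd3 hL) 0, Matrix.trace (((Y - H (D Y)) ⟨p.src, p.μ⟩ + (Y - H (D Y)) ⟨p.src.shift p.μ, p.ν⟩ - (Y - H (D Y)) ⟨p.src.shift p.ν, p.μ⟩ - (Y - H (D Y)) ⟨p.src, p.ν⟩) *
              (H (fderiv ℂ D Y (Pi.single b (Matrix.single j i (1 : ℂ)))) ⟨p.src, p.μ⟩ + H (fderiv ℂ D Y (Pi.single b (Matrix.single j i (1 : ℂ)))) ⟨p.src.shift p.μ, p.ν⟩ -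
                H (fderiv ℂ D Y (Pi.single b (Matrix.single j i (1 : ℂ)))) ⟨p.src.shift p.ν, p.μ⟩ - H (fderiv ℂ D Y (Pi.single b (Matrix.single j i (1 : ℂ)))) ⟨p.src, p.ν⟩))
            - ((((((ℓ + 1 : ℕ) : ℝ)⁻¹) ^ (K - n)) : ℝ) : ℂ) ^ 4 * ∑ b' : PBond (PV 2 ℓ m K hd3 hL) 0, Matrix.trace (W₀ (Y - H (D Y)) b' * H (fderiv ℂ D Y (Pi.single b (Matrix.single j i (1 : ℂ)))) b'))) →
        ∀ (Y : PBond (PV 2 ℓ m K hd3 hL) 0 → Matrix (Fin 2) (Fin 2) ℂ) (r : ℝ), r < a₃ → (∀ b, w 1 b * ‖Y b‖ ≤ r) →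
          (∀ (b : PBond (PV 2 ℓ m K hd3 hL) 0) (ν : Fin 3), w 2 b * ((ℓ + 1 : ℕ) : ℝ) ^ (K - n) * ‖Y ⟨b.src.shift ν, b.dir⟩ - Y b‖ ≤ r) →
          ∀ b, w 3 b * ‖(W₀ (Y - H (D Y)) + E Y) b‖ ≤
            (12 * (((ℓ + 1 : ℕ) : ℝ) ^ 3 * (1428 + ((ℓ + 1 : ℕ) : ℝ))) * (1 + 4 * BH * C₂ * Rc₀) ^ 2 +
              (2 * CX * C₂ + 2⁻¹ * (8 * C₃ * (2 * CP)) * (1 + 4 * BH * C₂ * Rc₀) +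
                (16 * K₀ * C₃) * Rc₀ * (12 * (((ℓ + 1 : ℕ) : ℝ) ^ 3 * (1428 + ((ℓ + 1 : ℕ) : ℝ)))) * (1 + 4 * BH * C₂ * Rc₀) ^ 2)) * r ^ 2 := by
  obtain ⟨Mh₀, R₀, BH, CX, K₀, CP, hBH, hCX, hK₀, hCP, hmain⟩ := hLetters_flatH_of_adm22 ℓ hL hℓ
  refine ⟨max Mh₀ 2, max R₀ 1, BH, CX, K₀, CP, hBH, hCX, hK₀, hCP, ?_⟩
  intro m hm n K hk1 hk' Mh R a' hMha hMh hR hsize x₀ ρ S hM hRS w hw H hHM u hu C D C₂ Rc Rc₀ a₃ C₃ hD h49 hDd hCd hCcol hsmall hC₃ hC₂ hR₀0 hR₀ ha₃ hθ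
  -- the datum is admissible; the four H-side letters at it
  have hAdm : Adm22 (cubeSeqMT3 (⟨ℓ + 1, hL, m, hm⟩ : T3Family) n K x₀ ρ S ((ℓ + 1) * Mh) hM) R ((ℓ + 1) * Mh) :=
    adm22_cubeSeqMT3 (⟨ℓ + 1, hL, m, hm⟩ : T3Family) n K x₀ ρ hM hRS
  have hDk : (cubeSeqMT3 (⟨ℓ + 1, hL, m, hm⟩ : T3Family) n K x₀ ρ S ((ℓ + 1) * Mh) hM).k = K - n :=
    cubeSeqMT3_k (⟨ℓ + 1, hL, m, hm⟩ : T3Family) n K x₀ ρ S ((ℓ + 1) * Mh) hM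
  obtain ⟨hH, hX1, hHcol, hCH⟩ := hmain m hm n K hk1 hk' hMha (le_trans (le_max_left _ _) hMh) (le_trans (le_max_left _ _) hR) hsize
    (cubeSeqMT3 (⟨ℓ + 1, hL, m, hm⟩ : T3Family) n K x₀ ρ S ((ℓ + 1) * Mh) hM) hDk hAdm w hw H hHM u hu
  -- the separation gives FILE C's `2L ≤ S`
  have hS : 2 * ((⟨ℓ + 1, hL, m, hm⟩ : T3Family)).L ≤ S := by
    show 2 * (ℓ + 1) ≤ S
    have hR1 : 1 ≤ R := le_trans (le_max_right _ _) hR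
    have hM2 : 2 ≤ Mh := le_trans (le_max_right _ _) hMh
    calc 2 * (ℓ + 1) = 1 * ((ℓ + 1) * 2) := by ring
      _ ≤ R * ((ℓ + 1) * Mh) := Nat.mul_le_mul hR1 (Nat.mul_le_mul_left _ hM2)
      _ ≤ S := hRS
  have hL0 : (0 : ℝ) < ((ℓ + 1 : ℕ) : ℝ) := by positivity
  have hη3 : 0 ≤ ((((ℓ + 1 : ℕ) : ℝ)) ^ (K - n)) ^ 3 := by positivity
  have hu0 : ∀ c, 0 ≤ u c := fun c => hη3.trans (hu c)
  have hCP2 : 0 ≤ 2 * CP := by positivity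
  have hw1 : ∀ b, 0 ≤ w 1 b := fun b => levWeight_nonneg hw 1 b
  by_cases ha₃0 : 0 ≤ a₃
  swap
  · -- `a₃ < 0`: no field has size `r < a₃` (sizes are nonnegative) — P3b's `W₀` with the vacuous bound
    obtain ⟨W₀, hgrad, hW₀d, -, -⟩ := exists_gradient_weighted98_cubeSeq_T3 (⟨ℓ + 1, hL, m, hm⟩ : T3Family) n K x₀ ρ S ((ℓ + 1) * Mh) hM hS hw
    refine ⟨W₀, hgrad, hW₀d, fun E _ Y r hr hY1 _ b => ?_⟩
    exfalso
    have h0 : 0 ≤ r := (mul_nonneg (hw1 b) (norm_nonneg _)).trans (hY1 b)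
    exact ha₃0 (h0.trans hr.le)
  rcases isEmpty_or_nonempty (BondIdx (cubeSeqMT3 (⟨ℓ + 1, hL, m, hm⟩ : T3Family) n K x₀ ρ S ((ℓ + 1) * Mh) hM)) with hE | hne
  · -- empty index set: `H = 0`, (46) holds with `B_H := 0`; the bound with `θ = 1` is below the displayed one
    have hz : ∀ (X : BondIdx (cubeSeqMT3 (⟨ℓ + 1, hL, m, hm⟩ : T3Family) n K x₀ ρ S ((ℓ + 1) * Mh) hM) → Matrix (Fin 2) (Fin 2) ℂ)
        (b : PBond (PV 2 ℓ m K hd3 hL) 0), H X b = 0 := fun X b => by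
      rw [hHM]; exact Finset.sum_of_isEmpty _
    have hH0 : ∀ (X : BondIdx (cubeSeqMT3 (⟨ℓ + 1, hL, m, hm⟩ : T3Family) n K x₀ ρ S ((ℓ + 1) * Mh) hM) → Matrix (Fin 2) (Fin 2) ℂ) (t : ℝ),
        (∀ c', ‖X c'‖ ≤ t) → (∀ b, w 1 b * ‖H X b‖ ≤ 0 * t) ∧
          ∀ (b : PBond (PV 2 ℓ m K hd3 hL) 0) (ν : Fin 3),
            w 2 b * ((ℓ + 1 : ℕ) : ℝ) ^ (K - n) * ‖H X ⟨b.src.shift ν, b.dir⟩ - H X b‖ ≤ 0 * t := by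
      intro X t _
      refine ⟨fun b => ?_, fun b ν => ?_⟩
      · rw [hz, norm_zero, mul_zero, zero_mul]
      · rw [hz, hz, sub_zero, norm_zero, mul_zero, zero_mul]
    have hθ0 : (1 + 4 * (0 : ℝ) * C₂ * Rc₀) * a₃ ≤ 1 / (2 * ((ℓ + 1 : ℕ) : ℝ)) := by
      have h1 : (1 + 4 * (0 : ℝ) * C₂ * Rc₀) * a₃ = a₃ := by ring
      have h2 : a₃ ≤ (1 + 4 * BH * C₂ * Rc₀) * a₃ := by
        have : 0 ≤ 4 * BH * C₂ * Rc₀ * a₃ := by positivity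
        linarith
      rw [h1]; exact h2.trans hθ
    obtain ⟨W₀, hgrad, hW₀d, hq⟩ := exists_hWq_dressed_cubeSeq_T3_of_columnLetters (⟨ℓ + 1, hL, m, hm⟩ : T3Family) n K x₀ ρ S ((ℓ + 1) * Mh) hM hS hw
      u hu0 H C D hH0 hD hX1 h49 hDd hCd hCcol hHcol hCH hsmall hC₃ hK₀ hCP2 hC₂ le_rfl hR₀0 hR₀ ha₃ hθ0
    refine ⟨W₀, hgrad, hW₀d, fun E hE Y r hr hY1 hY2 b => (hq E hE Y r hr hY1 hY2 b).trans (mul_le_mul_of_nonneg_right ?_ (sq_nonneg r))⟩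
    -- monotonicity of the constant in `θ ≥ 1`
    have e0 : (1 + 4 * (0 : ℝ) * C₂ * Rc₀) = 1 := by ring
    simp only [e0, one_pow, mul_one]
    have hθ1 : (1 : ℝ) ≤ 1 + 4 * BH * C₂ * Rc₀ := by
      have : 0 ≤ 4 * BH * C₂ * Rc₀ := by positivity
      linarith
    have hθsq : (1 : ℝ) ≤ (1 + 4 * BH * C₂ * Rc₀) ^ 2 := one_le_pow₀ hθ1
    have hC₀ : (0 : ℝ) ≤ 12 * (((ℓ + 1 : ℕ) : ℝ) ^ 3 * (1428 + ((ℓ + 1 : ℕ) : ℝ))) := by positivity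
    have ha : (0 : ℝ) ≤ 2⁻¹ * (8 * C₃ * (2 * CP)) := by positivity
    have hb : (0 : ℝ) ≤ 16 * K₀ * C₃ * Rc₀ * (12 * (((ℓ + 1 : ℕ) : ℝ) ^ 3 * (1428 + ((ℓ + 1 : ℕ) : ℝ)))) := by positivity
    have t1 := mul_le_mul_of_nonneg_left hθsq hC₀
    have t2 := mul_le_mul_of_nonneg_left hθ1 ha
    have t3 := mul_le_mul_of_nonneg_left hθsq hb
    linarith
  · -- nonempty index set: the four letters verbatim
    exact exists_hWq_dressed_cubeSeq_T3_of_columnLetters (⟨ℓ + 1, hL, m, hm⟩ : T3Family) n K x₀ ρ S ((ℓ + 1) * Mh) hM hS hw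
      u hu0 H C D (hH hne) hD hX1 h49 hDd hCd hCcol hHcol hCH hsmall hC₃ hK₀ hCP2 hC₂ hBH hR₀0 hR₀ ha₃ hθ

end Summit.QuantumFields.YangMills.Theorems.HalvingDressingLetter

end
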